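import Literature.MathematicalPhysics.QuantumFieldTheory.Balaban1983to89.B8Thm4ConcreteBdryBeta

/-!
# `Balaban1983to89.B8Thm4ExistsZd3BdryBeta` — [Balaban1985RegularSpaces] THEOREM 4 (p. 88), EXISTENCE HALF, on the `ℤᵈ × 𝔸` carriers and on
# index-mapped sub-families of `B8LeafModelZd3.zdGF3`, the (1.59) socket in EDITION β — `B8.Thm4ExistsBody cₑ (5dLB₀)` modulo the THREE existence
# sockets (Prop. 5 ∃ base ∕ ∃ step, [4] Thm 3.3 in β reading), NO uniqueness socket

statement-level skeleton of published theorems with citation tags; proofs where landed; nothing here is a claim about the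
Yang–Mills mass gap

T. Bałaban, *Spaces of regular gauge field configurations on a lattice and gauge fixing conditions*, Commun. Math. Phys. **99** (1985) 75–102
`[Balaban1985RegularSpaces]` ("B8"), Theorem 4 p. 88 («there exists exactly one gauge transformation u …»; existence pp. 88–94, uniqueness p. 95),
Proposition 6 p. 99.  PDF held: `paper:balaban1985-cmp99-regular-spaces-gauge-fixing` (journal page = PDF page + 74); p. 99 re-read this session
(text layer p0025): *«If 7dL²Mα₀ ≤ c₁, then the assumptions of Theorem 4 are satisfied for the pair of configurations 1, U₀″, thus there exists a gauge
transformation u such that U₁ = U₀″^{u⁻¹} satisfies the conditions (1.36)–(1.39)»* — Proposition 6 consumes Theorem 4's EXISTENCE half only.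

CITATION HEADER (lean-in-tree rule).  Cell `pub-ymgap` (HUMAN RULING D-0062, Track A), DAG node N05 = [B8], seat `pub-ymgap-dag-n05-e` g9 (R141 (C) row
s3b).  WHY THIS FILE.  The β junction chain of record (this seat g8: `B8Thm4ConcreteBdryBeta.thm4Printed_zd3_map_bdryβ` p546941 →
`B8Prop6CubeMemberGaugedBdryBeta` p545384 → `B8LeafKnitZd3CubBdryBeta.prop6Printed_zdCub_of_sockD4βFamily` p547598 →
`B8Prop6CubeMemberOfThm33Beta.prop6Printed_zdCub_of_thm33β(_uniform)` p550198 ∕ p563537) reads Theorem 4 WHOLE (`B8.Thm4Printed`, «exactly one»)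
and therefore carries Proposition 5's UNIQUENESS socket `SockP5u … cP cu`, although its Proposition-6 consumer discards the uniqueness conjunct
(`obtain ⟨u, hR, ⟨h137, hLan, h162⟩, -⟩`).  dag-n05-d g9 located it (bus 2026-08-27 19:53Z): «`SockP5u` [at the cube members] has NO in-tree provider —
n04-b's `sockP5uE_of_lettersU` needs `Ω₀ = ℤᵈ`; print's Prop. 6 needs no uniqueness».  dag-n05-c g2 typed the existence half in the R-d currency
(`B8Prop6CubeMemberExists.thm4Exists_concrete_uniform`, `B8Thm4HalvesZd3.thm4ExistsBody_member_zd3` ∕ `thm4ExistsBody_zd3_map`), vacuous at finite `Ω₀`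
(director-ym №189).  THIS FILE is the EXISTENCE HALF IN EDITION β: `B8Thm4ConcreteBdryBeta` §1–§3 with the uniqueness tail, the socket `SP5u`, the radius
`cu` and the member laws `htower`∕`hpart` (read by uniqueness only) REMOVED — nothing else changes (same driver `B8Thm4KLevelBdryBeta.
thm4_exists_all_levels_supp_landau138_bdryβ`, same windows, same (1.37) device `mlogCfg_spec` + `B8Eq142KLevelLocal.H42_of_inAx`).

WHAT THIS FILE PROVES (theorems only, no `def`; kind «kernel-checked proof»).
§1 ★ `thm4Exists_concrete_uniform_bdryβ` — THEOREM 4, EXISTENCE HALF, on the concrete carriers, member-generic over `(Ω, Λs, Λb)` with the nesting, the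
   bond-class laws `hbox`∕`hclass` and the boundary-layer law `hlay`: ONE threshold `cₑ(d, L, B₀, B₀′, c_P) > 0`; for `α₀ + α₁ ≤ cₑ` and every datum with
   (1.33), (1.34) (+ axial gauge at every truncation), (1.35) box form, (1.66)₀ THERE IS a unitary `u`, `= 1` off `Ω₀`, with (1.29) at `k` levels, `U′^{u⁻¹}`
   in the Landau gauge of record (1.38) (`k ≥ 1`) and of the (1.62)-shape `U′^{u⁻¹} = e^{iηA}`, `A = logCfg` Hermitian, `|A_b| ≤ 5dLB₀(α₀ + α₁)(Lʲη)⁻¹` on the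
   sides touching `Ω_j` — MODULO THE THREE EXISTENCE SOCKETS `SP5base`, `SP5`, `SH59Dβ` (the last = the body of dag-n06-b's `SockB9P3D4β` at the induction
   datum: averaging datum `|B₁|β` over `Λb m j ∪ {level-0 crossing bonds of Ω₀}`, exterior-collar term `B_∂·Φ₀`), `0 ≤ B_∂`, `4B_∂ ≤ (dL − 1)B₀`.
§2 ★ `thm4ExistsBody_member_zd3_bdryβ` — `B8.Thm4ExistsBody cₑ (5dLB₀)` AT ONE MEMBER of `zdGF3` (sockets inside; (1.37) `C137` via `mlogCfg`).
§3 ★ `thm4ExistsBody_zd3_map_bdryβ` — `∃ cₑ > 0, B8.Thm4ExistsBody cₑ (5dLB₀) (zdGF3 ∘ ι)` on an index-mapped sub-family whose members obey the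
   boundary-layer law, from the three β existence sockets on the image of `ι` — the `H4` of `B8Prop6CubeMemberGaugedBdryBetaExists` (this seat, next file).

HONEST SCOPE.  Assemblies BY NAME over landed modules; nothing of Propositions 3∕5, (1.42), (1.59) is proved; the three sockets are HYPOTHESES (object-bound:
Prop. 5's contraction with the letters of [4]; [4] Thm 3.3 WITH exterior data in the β reading — dag-n06-b's member supplier `sockB9P3D4β_allLevels_of_thm33_on`,
A6-witnessed at truncation 0 only); the β socket is FALSE below an absolute threshold in `B₀` (boundary pure-gauge mode; declared as in every β file; the
theorems hold for every `B₀ > 0`, the socket vacuous below the threshold).  `≤` where print has `<`; `T_η ↦ ℤᵈ`.  Count-neutral; N05 NOT discharged; one finite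
`T⁴` programme at fixed `ε`, Bałaban as printed — nothing continuum ∕ ℝ⁴ ∕ OS ∕ mass-gap ∕ Clay.  No `sorry`, no `def`, no `instance`, no `notation`.
Unit `pub-ymgap-dag-n05-e` (g9), 2026-08-27.

RELATED IN THE TREE, NOT DUPLICATED: `B8Thm4ConcreteBdryBeta` (the whole theorem in β; USED: imports, driver lemmas), `B8Prop6CubeMemberExists.thm4Exists_concrete_uniform`
∕ `B8Thm4HalvesZd3` (R-d existence half; shape template), `B8Thm4ExistsAtBdryBeta.thm4Exists_concrete_at_bdryβ` (existence half with the socket BODIES at the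
datum — the flat line's driver; this file keeps the named sockets `SockP5base`∕`SockP5` of the junction currency).
-/

noncomputable section

open NormedSpace

namespace Literature.MathematicalPhysics.QuantumFieldTheory.Balaban1983to89.B8Thm4ExistsZd3BdryBeta

open Complex (I)
open MatrixLog B7Prop1Explicit B7Prop2Explicit B7Prop1Local B7Eq92Concrete
open B7Prop2Explicit (C0 c2')
open B7Prop3Flat (c3)
open B8Ineq132 (covDerivFwd InAk BondTouches)
open B8Eq119TwistedAxial (Restr129 InAx)
open B8Eq184Proof (gaugeExp cfgExp)
open B8Lemma1NonAbelian (mulCfg)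
open B8Eq140Level (SideTouches)
open B8Eq146AExpansion (iEta)
open B7Prop4GeneralLevels (logCovIter linCovIter)
open B8Eq155JBound (Jcur wsup)
open B8ScaledSupNorm (bondNorm msup)
open B8Thm2LogB (blockTop)
open B8Ineq130 (tlo thi)
open B8Eq138LandauZd (IsLandau138W logCfg)
open B8Prop3GaugeFixedKLevel (eq_mgauge_inv_of_mgauge_eq mem_unitaryUnits_of_mgauge_eq logField_spec)
open B8Thm4KLevelBdryBeta (thm4_exists_all_levels_supp_landau138_bdryβ)
open B8Thm4Windows (thm4_windows thm4_windows_extra)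
open B8Thm4AtLandau138 (mgauge_mgauge_inv)
open B8LeafModelZd (SockP5base SockP5 ZdIdx)
open B8LeafModelZd3 (mlogCfg mlogCfg_spec zdGF3)
open B9SupplySockB9P3ZdBeta (CrossB)

-- `Site` alone could resolve to the torus sites of `Setup.lean`; re-export the `ℤ^d` sites of `B7Prop1Explicit`.
export B7Prop1Explicit (Site)

variable {d : ℕ}

/-! ## §1 Theorem 4, existence half, on the `ℤᵈ` carriers, one threshold, the (1.59) socket in edition β -/

section Main

variable {𝔸 : Type*} [CStarAlgebra 𝔸] [Nontrivial 𝔸]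

/-- ★ **THEOREM 4 (p. 88), EXISTENCE HALF, ON THE `ℤᵈ` CARRIERS, ONE THRESHOLD BEFORE THE DATA, THE (1.59) SOCKET IN EDITION β** —
`B8Thm4ConcreteBdryBeta.thm4Body_concrete_uniform_bdryβ` with the uniqueness clause, the socket `SP5u`, the radius `cu` and the laws `htower`∕`hpart` removed:
for `α₀ + α₁ ≤ cₑ`, every datum `(U₀, U′)` with (1.33), (1.34), axial gauge, (1.35) box form and (1.66)₀ has a unitary `u`, `= 1` off `Ω₀`, with (1.29),
(1.38) for `U′^{u⁻¹}` (`k ≥ 1`) and the (1.62)-shape with `logCfg`, modulo `SP5base`, `SP5` and the β (1.59) socket `SH59Dβ` (support clause, `|B₁|β`,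
exterior-collar term `B_∂·Φ₀`).  Proof = the existence part of the whole-theorem proof verbatim.
[cite: Balaban1985RegularSpaces, Thm 4 p.88, (1.29) p.81, (1.31) p.82, (1.38) p.82, (1.58)–(1.62) pp.86–87, (1.66) p.87, Prop. 5 (1.107)–(1.108) p.94, pp.88–94] -/
theorem thm4Exists_concrete_uniform_bdryβ (hd2 : 2 ≤ d) {L : ℕ} (hL : 2 ≤ L)
    {B₀ B₀' cP Bbd : ℝ} (hB₀ : 0 < B₀) (hB₀' : 0 < B₀') (hB : 2 ≤ 5 * (d : ℝ) * L * B₀) (hcP : 0 < cP)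
    (hBbd : 0 ≤ Bbd) (hBd : 4 * Bbd ≤ ((d : ℝ) * L - 1) * B₀) :
    ∃ c₁ : ℝ, 0 < c₁ ∧ ∀ (η : ℝ), 0 < η → ∀ (k : ℕ)
    (Ω : ℕ → Set (Site d)) (hΩ : ∀ j, Ω (j + 1) ⊆ Ω j) (Λs : ℕ → ℕ → Set (Site d)) (Λb : ℕ → ℕ → Set (Site d × Fin d))
    (hbox : ∀ m, m ≤ k → ∀ j, j ≤ m → ∀ c ∈ Λb m j, ∀ x, InBox (loK L j c.1) (bondHiK L j c.1 c.2) x → x ∈ Ω j)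
    (hclass : ∀ m, m ≤ k → ∀ j, j ≤ m → ∀ c ∈ Λb m j,
      (c.1 ∈ Λs m j ∧ c.1 + e c.2 ∈ Λs m j) ∨
      (∃ j', j = j' + 1 ∧ (∀ x, (L : ℤ) • c.1 ≤ x → x ≤ (L : ℤ) • c.1 + blockTop L → x ∈ Λs m j') ∧ c.1 + e c.2 ∈ Λs m j) ∨
      (∃ j', j = j' + 1 ∧ c.1 ∈ Λs m j ∧ (∀ x, (L : ℤ) • (c.1 + e c.2) ≤ x → x ≤ (L : ℤ) • (c.1 + e c.2) + blockTop L → x ∈ Λs m j')))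
    (hlay : ∀ m, 1 ≤ m → m ≤ k → ∀ y z : Site d, y ∈ Ω 0 → z ∉ Ω 0 → (∀ i, y i - 1 ≤ z i ∧ z i ≤ y i + 1) → y ∈ Λs m 0)
    (SP5base : ∀ α₀ α₁ : ℝ, 0 < α₀ → 0 < α₁ → α₀ + α₁ ≤ cP →
      ∀ U₀ U' : Site d → Fin d → 𝔸ˣ, (∀ x κ, U₀ x κ ∈ unitaryUnits 𝔸) → (∀ x κ, U' x κ ∈ unitaryUnits 𝔸) →
      InAk L k η α₀ Ω U₀ → InAk L k η α₀ Ω (mulCfg U' U₀) → (∀ m, m ≤ k → InAx L m (Λs m) U₀ (mulCfg U' U₀)) →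
      (∀ j, j ≤ k → ∀ (z : Site d) (μ : Fin d), (∀ x, InBox (loK L j z) (bondHiK L j z μ) x → x ∈ Ω j) →
        ‖(avgIter L (mulCfg U' U₀) j z μ : 𝔸) - (avgIter L U₀ j z μ : 𝔸)‖ ≤ α₁) →
      (∀ b ∈ {b : Site d × Fin d | SideTouches (Ω 0) b.1 b.2}, ‖((U' b.1 b.2 : 𝔸ˣ) : 𝔸) - 1‖ ≤ α₁) →
      (∃ (v : Site d → 𝔸ˣ) (lam : Site d → 𝔸), (∀ x, v x ∈ unitaryUnits 𝔸) ∧ (∀ x, x ∉ Ω 0 → v x = 1) ∧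
        (∀ j, j ≤ 1 → ∀ b ∈ {b : Site d × Fin d | SideTouches (Ω j) b.1 b.2}, (v b.1 : 𝔸) = ((gaugeExp lam b.1 : 𝔸ˣ) : 𝔸) ∧
        (v (b.1 + e b.2) : 𝔸) = ((gaugeExp lam (b.1 + e b.2) : 𝔸ˣ) : 𝔸)) ∧
        (∀ j, j ≤ 1 → ∀ b ∈ {b : Site d × Fin d | SideTouches (Ω j) b.1 b.2},
        ‖lam b.1‖ ≤ (8 * B₀' * (5 * (d : ℝ) * L * B₀) * (α₀ + α₁)) ∧ ((L : ℝ) ^ j * η) * ‖covDerivFwd η U₀ b.2 lam b.1‖ ≤ (8 * B₀' * (5 * (d : ℝ) * L * B₀) * (α₀ + α₁))) ∧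
        IsLandau138W L 1 η (Ω 0) (Λs 1) U₀ (mgauge U₀ v⁻¹ U') ∧ Restr129 L 1 (Λs 1) U₀ ((1 : Site d → 𝔸ˣ) * v)))
    (SP5 : ∀ α₀ α₁ : ℝ, 0 < α₀ → 0 < α₁ → α₀ + α₁ ≤ cP →
      ∀ U₀ U' : Site d → Fin d → 𝔸ˣ, (∀ x κ, U₀ x κ ∈ unitaryUnits 𝔸) → (∀ x κ, U' x κ ∈ unitaryUnits 𝔸) →
      InAk L k η α₀ Ω U₀ → InAk L k η α₀ Ω (mulCfg U' U₀) → (∀ m, m ≤ k → InAx L m (Λs m) U₀ (mulCfg U' U₀)) →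
      (∀ j, j ≤ k → ∀ (z : Site d) (μ : Fin d), (∀ x, InBox (loK L j z) (bondHiK L j z μ) x → x ∈ Ω j) →
        ‖(avgIter L (mulCfg U' U₀) j z μ : 𝔸) - (avgIter L U₀ j z μ : 𝔸)‖ ≤ α₁) →
      (∀ b ∈ {b : Site d × Fin d | SideTouches (Ω 0) b.1 b.2}, ‖((U' b.1 b.2 : 𝔸ˣ) : 𝔸) - 1‖ ≤ α₁) →
      (∀ m, 1 ≤ m → m < k → ∀ (u₁ : Site d → 𝔸ˣ) (U₁ : Site d → Fin d → 𝔸ˣ) (A : Site d → Fin d → 𝔸),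
        (∀ x, u₁ x ∈ unitaryUnits 𝔸) → (∀ x, x ∉ Ω 0 → u₁ x = 1) → mgauge U₀ u₁ U₁ = U' → Restr129 L m (Λs m) U₀ u₁ →
        IsLandau138W L m η (Ω 0) (Λs m) U₀ U₁ →
        (∀ j, j ≤ m → ∀ b ∈ {b : Site d × Fin d | SideTouches (Ω j) b.1 b.2},
        U₁ b.1 b.2 = cfgExp η A b.1 b.2 ∧ IsSelfAdjoint (A b.1 b.2) ∧ ‖A b.1 b.2‖ ≤ (5 * (d : ℝ) * L * B₀ * (α₀ + α₁)) * ((L : ℝ) ^ j * η)⁻¹) →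
        ∃ (v : Site d → 𝔸ˣ) (lam : Site d → 𝔸), (∀ x, v x ∈ unitaryUnits 𝔸) ∧ (∀ x, x ∉ Ω 0 → v x = 1) ∧
        (∀ j, j ≤ m + 1 → ∀ b ∈ {b : Site d × Fin d | SideTouches (Ω j) b.1 b.2}, (v b.1 : 𝔸) = ((gaugeExp lam b.1 : 𝔸ˣ) : 𝔸) ∧
        (v (b.1 + e b.2) : 𝔸) = ((gaugeExp lam (b.1 + e b.2) : 𝔸ˣ) : 𝔸)) ∧
        (∀ j, j ≤ m + 1 → ∀ b ∈ {b : Site d × Fin d | SideTouches (Ω j) b.1 b.2},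
        ‖lam b.1‖ ≤ (8 * B₀' * (5 * (d : ℝ) * L * B₀) * (α₀ + α₁)) ∧ ((L : ℝ) ^ j * η) * ‖covDerivFwd η U₀ b.2 lam b.1‖ ≤ (8 * B₀' * (5 * (d : ℝ) * L * B₀) * (α₀ + α₁))) ∧
        IsLandau138W L (m + 1) η (Ω 0) (Λs (m + 1)) U₀ (mgauge U₀ v⁻¹ U₁) ∧ Restr129 L (m + 1) (Λs (m + 1)) U₀ (u₁ * v)))
    (SH59Dβ : ∀ α₀ α₁ : ℝ, 0 < α₀ → 0 < α₁ → α₀ + α₁ ≤ cP →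
      ∀ U₀ U' : Site d → Fin d → 𝔸ˣ, (∀ x κ, U₀ x κ ∈ unitaryUnits 𝔸) → (∀ x κ, U' x κ ∈ unitaryUnits 𝔸) →
      InAk L k η α₀ Ω U₀ → InAk L k η α₀ Ω (mulCfg U' U₀) → (∀ m, m ≤ k → InAx L m (Λs m) U₀ (mulCfg U' U₀)) →
      (∀ j, j ≤ k → ∀ (z : Site d) (μ : Fin d), (∀ x, InBox (loK L j z) (bondHiK L j z μ) x → x ∈ Ω j) →
        ‖(avgIter L (mulCfg U' U₀) j z μ : 𝔸) - (avgIter L U₀ j z μ : 𝔸)‖ ≤ α₁) →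
      (∀ b ∈ {b : Site d × Fin d | SideTouches (Ω 0) b.1 b.2}, ‖((U' b.1 b.2 : 𝔸ˣ) : 𝔸) - 1‖ ≤ α₁) →
      (∀ m, 1 ≤ m → m ≤ k → ∀ (u : Site d → 𝔸ˣ) (W : Site d → Fin d → 𝔸ˣ) (A' : Site d → Fin d → 𝔸),
        (∀ x, u x ∈ unitaryUnits 𝔸) → (∀ x, x ∉ Ω 0 → u x = 1) → mgauge U₀ u W = U' → Restr129 L m (Λs m) U₀ u →
        IsLandau138W L m η (Ω 0) (Λs m) U₀ W → (∀ y τ, IsSelfAdjoint (A' y τ)) →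
        (∀ j, j ≤ m → ∀ y τ, SideTouches (Ω j) y τ →
        W y τ = cfgExp η A' y τ ∧ ‖A' y τ‖ ≤ (2 * (L * (5 * (d : ℝ) * L * B₀ * (α₀ + α₁))) + 8 * (8 * B₀' * (5 * (d : ℝ) * L * B₀) * (α₀ + α₁))) * ((L : ℝ) ^ j * η)⁻¹) →
        (∀ y τ, (∀ j, j ≤ m → ¬ SideTouches (Ω j) y τ) → A' y τ = 0) →
        msup L m η (-(1 : ℝ)) (fun j (b : Site d × Fin d) => SideTouches (Ω j) b.1 b.2) (fun b => A' b.1 b.2)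
        ≤ B₀ * (bondNorm L m η (-(3 : ℝ)) Ω (fun x μ => Jcur η U₀ A' μ x)
        + wsup 1 (fun p : {p : ℕ × (Site d × Fin d) // p.1 ≤ m ∧ (p.2 ∈ Λb m p.1 ∨ (p.1 = 0 ∧ CrossB (Ω 0) p.2))} =>
        linCovIter L U₀ (iEta η A') p.1.1 p.1.2.1 p.1.2.2))
        + Bbd * msup L m η (-(1 : ℝ)) (fun j (b : Site d × Fin d) => j = 0 ∧ SideTouches (Ω 0) b.1 b.2 ∧ ¬ BondTouches (Ω 0) b.1 b.2)
            (fun b => A' b.1 b.2) ∧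
        msup L m η (-(2 : ℝ)) (fun j (t : Fin d × Fin d × Site d) => SideTouches (Ω j) t.2.2 t.2.1)
        (fun t => covDerivFwd η U₀ t.1 (fun z => A' z t.2.1) t.2.2)
        ≤ B₀ * (bondNorm L m η (-(3 : ℝ)) Ω (fun x μ => Jcur η U₀ A' μ x)
        + wsup 1 (fun p : {p : ℕ × (Site d × Fin d) // p.1 ≤ m ∧ (p.2 ∈ Λb m p.1 ∨ (p.1 = 0 ∧ CrossB (Ω 0) p.2))} =>
        linCovIter L U₀ (iEta η A') p.1.1 p.1.2.1 p.1.2.2))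
        + Bbd * msup L m η (-(1 : ℝ)) (fun j (b : Site d × Fin d) => j = 0 ∧ SideTouches (Ω 0) b.1 b.2 ∧ ¬ BondTouches (Ω 0) b.1 b.2)
            (fun b => A' b.1 b.2))),
      ∀ α₀ α₁ : ℝ, 0 < α₀ → 0 < α₁ → α₀ + α₁ ≤ c₁ →
      ∀ U₀ U' : Site d → Fin d → 𝔸ˣ, (∀ x κ, U₀ x κ ∈ unitaryUnits 𝔸) → (∀ x κ, U' x κ ∈ unitaryUnits 𝔸) →
      InAk L k η α₀ Ω U₀ → InAk L k η α₀ Ω (mulCfg U' U₀) → (∀ m, m ≤ k → InAx L m (Λs m) U₀ (mulCfg U' U₀)) →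
      (∀ j, j ≤ k → ∀ (z : Site d) (μ : Fin d), (∀ x, InBox (loK L j z) (bondHiK L j z μ) x → x ∈ Ω j) →
        ‖(avgIter L (mulCfg U' U₀) j z μ : 𝔸) - (avgIter L U₀ j z μ : 𝔸)‖ ≤ α₁) →
      (∀ b ∈ {b : Site d × Fin d | SideTouches (Ω 0) b.1 b.2}, ‖((U' b.1 b.2 : 𝔸ˣ) : 𝔸) - 1‖ ≤ α₁) →
      ∃ u : Site d → 𝔸ˣ, (∀ x, u x ∈ unitaryUnits 𝔸) ∧ (∀ x, x ∉ Ω 0 → u x = 1) ∧ Restr129 L k (Λs k) U₀ u ∧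
        (1 ≤ k → IsLandau138W L k η (Ω 0) (Λs k) U₀ (mgauge U₀ u⁻¹ U')) ∧
        (∀ j, j ≤ k → ∀ b ∈ {b : Site d × Fin d | SideTouches (Ω j) b.1 b.2},
          mgauge U₀ u⁻¹ U' b.1 b.2 = cfgExp η (logCfg η (mgauge U₀ u⁻¹ U')) b.1 b.2 ∧
            IsSelfAdjoint (logCfg η (mgauge U₀ u⁻¹ U') b.1 b.2) ∧
            ‖logCfg η (mgauge U₀ u⁻¹ U') b.1 b.2‖ ≤ (5 * (d : ℝ) * L * B₀ * (α₀ + α₁)) * ((L : ℝ) ^ j * η)⁻¹) := by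
  have hL1 : 1 ≤ L := le_trans (by norm_num) hL
  have hd1 : 1 ≤ d := le_trans (by norm_num) hd2
  have hd' : (1 : ℝ) ≤ d := by exact_mod_cast hd1
  have hL' : (1 : ℝ) ≤ L := by exact_mod_cast hL1
  obtain ⟨c₁, hc₁, hw⟩ := thm4_windows hd1 hL1 hB₀ hB₀' hB
  obtain ⟨c₂, hc₂, hw'⟩ := thm4_windows_extra (d := d) hL1
  refine ⟨min (min c₁ c₂) cP, lt_min (lt_min hc₁ hc₂) hcP, ?_⟩
  intro η hη k Ω hΩ Λs Λb hbox hclass hlay SP5base SP5 SH59Dβ α₀ α₁ hα₀ hα₁ hS U₀ U' hU₀ hU' h33 h34 hAx h135 h66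
  have hS1 : α₀ + α₁ ≤ c₁ := hS.trans ((min_le_left _ _).trans (min_le_left _ _))
  have hS2 : α₀ + α₁ ≤ c₂ := hS.trans ((min_le_left _ _).trans (min_le_right _ _))
  have hSP : α₀ + α₁ ≤ cP := hS.trans (min_le_right _ _)
  have hS0 : 0 ≤ α₀ + α₁ := by linarith
  obtain ⟨w1, w2, w3, w4, w5, w6, w7, w8, w9, w10, w11, w12, w13, w14, w15, w16, w17, w18⟩ :=
    hw α₀ α₁ hα₀ hα₁ hS1 (5 * (d : ℝ) * L * B₀ * (α₀ + α₁)) (8 * B₀' * (5 * (d : ℝ) * L * B₀) * (α₀ + α₁)) rfl rfl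
  obtain ⟨w19, w20⟩ := hw' α₀ α₁ hα₀ hα₁ hS2
  have hcs0 : 0 ≤ 5 * (d : ℝ) * L * B₀ * (α₀ + α₁) := by positivity
  have hα₄0 : 0 ≤ 8 * B₀' * (5 * (d : ℝ) * L * B₀) * (α₀ + α₁) := by positivity
  -- EXISTENCE (support form) at the top level `k`
  -- the exterior-collar window at the datum's (1.66)₀ level `a := α₁`
  have hbdry : 4 * Bbd * α₁ ≤ ((d : ℝ) * L - 1) * B₀ * (α₀ + α₁) := by
    have h1 : 4 * Bbd * α₁ ≤ ((d : ℝ) * L - 1) * B₀ * α₁ := mul_le_mul_of_nonneg_right hBd hα₁.le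
    have h2 : 0 ≤ ((d : ℝ) * L - 1) * B₀ := le_trans (by positivity) hBd
    have h3 : ((d : ℝ) * L - 1) * B₀ * α₁ ≤ ((d : ℝ) * L - 1) * B₀ * (α₀ + α₁) :=
      mul_le_mul_of_nonneg_left (le_add_of_nonneg_left hα₀.le) h2
    exact h1.trans h3
  obtain ⟨u, hu, huS, h129, W, hW, hLan, A, hA⟩ := thm4_exists_all_levels_supp_landau138_bdryβ hd2 hη hL k hU₀ hU' hα₀ hα₁ hα₄0 hB₀.le
    rfl w1 w2 w3 w4 w5 w6 w7 w8 w9 w10 w11 w12 w19 hBbd hα₁.le hbdry w13 w14 Ω hΩ Λs Λb hbox hclass h33 h34 hAx h135 h66 hlay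
    (le_mul_of_one_le_left hα₁.le (one_le_mul_of_one_le_of_one_le hd' hL'))
    (SP5base α₀ α₁ hα₀ hα₁ hSP U₀ U' hU₀ hU' h33 h34 hAx h135 h66) (SP5 α₀ α₁ hα₀ hα₁ hSP U₀ U' hU₀ hU' h33 h34 hAx h135 h66)
    (SH59Dβ α₀ α₁ hα₀ hα₁ hSP U₀ U' hU₀ hU' h33 h34 hAx h135 h66) k le_rfl
  have hWeq : W = mgauge U₀ u⁻¹ U' := eq_mgauge_inv_of_mgauge_eq hW
  have hWu : ∀ x κ, W x κ ∈ unitaryUnits 𝔸 := mem_unitaryUnits_of_mgauge_eq hU₀ hU' hu hW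
  -- `c⋆ ≤ 1/16` for the logarithm device
  have hc16 : 5 * (d : ℝ) * L * B₀ * (α₀ + α₁) ≤ 1 / 16 := by
    have h₁ : (1 : ℝ) * (5 * (d : ℝ) * L * B₀ * (α₀ + α₁)) ≤ L * (5 * (d : ℝ) * L * B₀ * (α₀ + α₁)) :=
      mul_le_mul_of_nonneg_right hL' hcs0
    linarith
  -- the exponent read back as `logCfg`
  have hleaf : ∀ j, j ≤ k → ∀ b ∈ {b : Site d × Fin d | SideTouches (Ω j) b.1 b.2},
      mgauge U₀ u⁻¹ U' b.1 b.2 = cfgExp η (logCfg η (mgauge U₀ u⁻¹ U')) b.1 b.2 ∧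
        IsSelfAdjoint (logCfg η (mgauge U₀ u⁻¹ U') b.1 b.2) ∧
        ‖logCfg η (mgauge U₀ u⁻¹ U') b.1 b.2‖ ≤ (5 * (d : ℝ) * L * B₀ * (α₀ + α₁)) * ((L : ℝ) ^ j * η)⁻¹ := by
    intro j hj b hb
    obtain ⟨hexp, -, hbd⟩ := hA j hj b hb
    have hbd' : ‖A b.1 b.2‖ ≤ (5 * (d : ℝ) * L * B₀ * (α₀ + α₁)) * η⁻¹ := by
      refine hbd.trans ?_
      have hLj : (1 : ℝ) ≤ (L : ℝ) ^ j := one_le_pow₀ hL'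
      have : ((L : ℝ) ^ j * η)⁻¹ ≤ η⁻¹ := by
        rw [mul_inv]
        calc ((L : ℝ) ^ j)⁻¹ * η⁻¹ ≤ 1 * η⁻¹ := by gcongr; exact inv_le_one_of_one_le₀ hLj
          _ = η⁻¹ := one_mul _
      exact mul_le_mul_of_nonneg_left this hcs0
    obtain ⟨hlogA, hsa, hWexp⟩ := logField_spec hη U₀ hWu hexp hbd' hc16
    rw [← hWeq]
    refine ⟨hWexp, ?_, ?_⟩
    · simpa [logCfg] using hsa
    · show ‖logCfg η W b.1 b.2‖ ≤ _
      rw [logCfg, hlogA]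
      exact hbd
  exact ⟨u, hu, huS, h129, fun hk => hWeq ▸ hLan hk, hleaf⟩

end Main

#print axioms thm4Exists_concrete_uniform_bdryβ

/-! ## §2 The member sentence and the existence half on index-mapped sub-families -/

section Member

variable {𝔸 : Type} [CStarAlgebra 𝔸] [Nontrivial 𝔸]

/-- ★ **`B8.Thm4ExistsBody cₑ (5dLB₀)` AT ONE MEMBER of `zdGF3`, SOCKETS INSIDE, THE (1.59) SOCKET IN EDITION β** (Theorem 4, existence, p. 88):
`B8Thm4ConcreteBdryBeta.thm4Body_member_zd3_bdryβ` minus the uniqueness branch — ONE threshold `cₑ(d, L, B₀, B₀′, c_P)`; the member's boundary-layer law;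
sockets `SockP5base` ∕ `SockP5` ∕ the β (1.59) socket (INLINE, the body of `SockB9P3D4β` at the induction datum) AT THAT MEMBER; (1.29) `Restricted`, (1.37)
`C137` via the canonical masked exponent `mlogCfg`, (1.38) `Landau`, (1.62) `C162` with `logCfg`.
[cite: Balaban1985RegularSpaces, Thm 4 p.88, (1.29) p.81, (1.31) p.82, (1.37)–(1.38) p.82, (1.58)–(1.62) pp.86–87, Prop. 5 (1.107)–(1.108) p.94] -/
theorem thm4ExistsBody_member_zd3_bdryβ (hd2 : 2 ≤ d) {L : ℕ} (hL : 2 ≤ L) (β : ℝ) (len : Site d → ℝ) {B₀ B₀' cP Bbd : ℝ} (hB₀ : 0 < B₀)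
    (hB₀' : 0 < B₀') (hB : 2 ≤ 5 * (d : ℝ) * L * B₀) (hcP : 0 < cP) (hBbd : 0 ≤ Bbd) (hBd : 4 * Bbd ≤ ((d : ℝ) * L - 1) * B₀) :
    ∃ c₁ : ℝ, 0 < c₁ ∧ ∀ i : ZdIdx d L,
      -- the boundary-layer law of the member: a site of `Ω₀` with a sup-distance-1 neighbour outside `Ω₀` lies in `Λs m 0`, `1 ≤ m ≤ k`
      (∀ m, 1 ≤ m → m ≤ i.k → ∀ y z : Site d, y ∈ i.Ω 0 → z ∉ i.Ω 0 → (∀ l, y l - 1 ≤ z l ∧ z l ≤ y l + 1) → y ∈ i.Λs m 0) →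
      SockP5base (𝔸 := 𝔸) L B₀ B₀' cP i.η i.k i.Ω i.Λs → SockP5 (𝔸 := 𝔸) L B₀ B₀' cP i.η i.k i.Ω i.Λs →
      -- the (1.59) socket IN THE REPAIRED CURRENCY at this member (support clause; exterior-collar term with constant `Bbd`)
      (∀ α₀ α₁ : ℝ, 0 < α₀ → 0 < α₁ → α₀ + α₁ ≤ cP →
        ∀ U₀ U' : Site d → Fin d → 𝔸ˣ, (∀ x κ, U₀ x κ ∈ unitaryUnits 𝔸) → (∀ x κ, U' x κ ∈ unitaryUnits 𝔸) →
        InAk L i.k i.η α₀ i.Ω U₀ → InAk L i.k i.η α₀ i.Ω (mulCfg U' U₀) → (∀ m, m ≤ i.k → InAx L m (i.Λs m) U₀ (mulCfg U' U₀)) →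
        (∀ j, j ≤ i.k → ∀ (z : Site d) (μ : Fin d), (∀ x, InBox (loK L j z) (bondHiK L j z μ) x → x ∈ i.Ω j) →
          ‖(avgIter L (mulCfg U' U₀) j z μ : 𝔸) - (avgIter L U₀ j z μ : 𝔸)‖ ≤ α₁) →
        (∀ b ∈ {b : Site d × Fin d | SideTouches (i.Ω 0) b.1 b.2}, ‖((U' b.1 b.2 : 𝔸ˣ) : 𝔸) - 1‖ ≤ α₁) →
        (∀ m, 1 ≤ m → m ≤ i.k → ∀ (u : Site d → 𝔸ˣ) (W : Site d → Fin d → 𝔸ˣ) (A' : Site d → Fin d → 𝔸),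
          (∀ x, u x ∈ unitaryUnits 𝔸) → (∀ x, x ∉ i.Ω 0 → u x = 1) → mgauge U₀ u W = U' → Restr129 L m (i.Λs m) U₀ u →
          IsLandau138W L m i.η (i.Ω 0) (i.Λs m) U₀ W → (∀ y τ, IsSelfAdjoint (A' y τ)) →
          (∀ j, j ≤ m → ∀ y τ, SideTouches (i.Ω j) y τ →
          W y τ = cfgExp i.η A' y τ ∧ ‖A' y τ‖ ≤ (2 * (L * (5 * (d : ℝ) * L * B₀ * (α₀ + α₁))) + 8 * (8 * B₀' * (5 * (d : ℝ) * L * B₀) * (α₀ + α₁))) * ((L : ℝ) ^ j * i.η)⁻¹) →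
          (∀ y τ, (∀ j, j ≤ m → ¬ SideTouches (i.Ω j) y τ) → A' y τ = 0) →
          msup L m i.η (-(1 : ℝ)) (fun j (b : Site d × Fin d) => SideTouches (i.Ω j) b.1 b.2) (fun b => A' b.1 b.2)
          ≤ B₀ * (bondNorm L m i.η (-(3 : ℝ)) i.Ω (fun x μ => Jcur i.η U₀ A' μ x)
          + wsup 1 (fun p : {p : ℕ × (Site d × Fin d) // p.1 ≤ m ∧ (p.2 ∈ i.Λb m p.1 ∨ (p.1 = 0 ∧ CrossB (i.Ω 0) p.2))} =>
          linCovIter L U₀ (iEta i.η A') p.1.1 p.1.2.1 p.1.2.2))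
          + Bbd * msup L m i.η (-(1 : ℝ)) (fun j (b : Site d × Fin d) => j = 0 ∧ SideTouches (i.Ω 0) b.1 b.2 ∧ ¬ BondTouches (i.Ω 0) b.1 b.2)
              (fun b => A' b.1 b.2) ∧
          msup L m i.η (-(2 : ℝ)) (fun j (t : Fin d × Fin d × Site d) => SideTouches (i.Ω j) t.2.2 t.2.1)
          (fun t => covDerivFwd i.η U₀ t.1 (fun z => A' z t.2.1) t.2.2)
          ≤ B₀ * (bondNorm L m i.η (-(3 : ℝ)) i.Ω (fun x μ => Jcur i.η U₀ A' μ x)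
          + wsup 1 (fun p : {p : ℕ × (Site d × Fin d) // p.1 ≤ m ∧ (p.2 ∈ i.Λb m p.1 ∨ (p.1 = 0 ∧ CrossB (i.Ω 0) p.2))} =>
          linCovIter L U₀ (iEta i.η A') p.1.1 p.1.2.1 p.1.2.2))
          + Bbd * msup L m i.η (-(1 : ℝ)) (fun j (b : Site d × Fin d) => j = 0 ∧ SideTouches (i.Ω 0) b.1 b.2 ∧ ¬ BondTouches (i.Ω 0) b.1 b.2)
              (fun b => A' b.1 b.2))) →
      B8.Thm4ExistsBody c₁ (5 * (d : ℝ) * L * B₀) (fun _ : Unit => (zdGF3 𝔸 L β len i).toGFData) := by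
  have hL1 : 1 ≤ L := le_trans (by norm_num) hL
  have hd1 : 1 ≤ d := le_trans (by norm_num) hd2
  have hL' : (1 : ℝ) ≤ L := by exact_mod_cast hL1
  obtain ⟨c₁, hc₁, H⟩ := thm4Exists_concrete_uniform_bdryβ (𝔸 := 𝔸) hd2 hL hB₀ hB₀' hB hcP hBbd hBd
  obtain ⟨cw, hcw, hw⟩ := thm4_windows hd1 hL1 hB₀ hB₀' hB
  obtain ⟨cw', hcw', hw'⟩ := thm4_windows_extra (d := d) hL1
  refine ⟨min c₁ (min cw cw'), lt_min hc₁ (lt_min hcw hcw'), ?_⟩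
  intro i hlay SP5base SP5 SH59Dβ _ α₀ α₁ hα₀ hα₁ hs U₀ P hInA _ hInAAx h166
  have hs₁ : α₀ + α₁ ≤ c₁ := hs.trans (min_le_left _ _)
  have hsw : α₀ + α₁ ≤ cw := hs.trans ((min_le_right _ _).trans (min_le_left _ _))
  have hsw' : α₀ + α₁ ≤ cw' := hs.trans ((min_le_right _ _).trans (min_le_right _ _))
  obtain ⟨hP1, h34, hAx⟩ := hInAAx
  obtain ⟨h135, h66⟩ := h166
  subst hP1
  obtain ⟨u, hu, huS, h129, hLan, hleaf⟩ := H i.η i.hη i.k i.Ω i.hΩ i.Λs i.Λb i.hbox i.hclass hlay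
    SP5base SP5 SH59Dβ α₀ α₁ hα₀ hα₁ hs₁ P.1.1 P.2.1 P.1.2 P.2.2 hInA h34 hAx h135 h66
  -- windows for the (1.42) lemma
  obtain ⟨-, -, -, -, w5, w6, w7, -, w9, w10, -, -, -, -, -, -, -, -⟩ :=
    hw α₀ α₁ hα₀ hα₁ hsw (5 * (d : ℝ) * L * B₀ * (α₀ + α₁)) (8 * B₀' * (5 * (d : ℝ) * L * B₀) * (α₀ + α₁)) rfl rfl
  obtain ⟨w19, -⟩ := hw' α₀ α₁ hα₀ hα₁ hsw'
  have hcs0 : 0 ≤ 5 * (d : ℝ) * L * B₀ * (α₀ + α₁) := by positivity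
  have hKS0 : 0 ≤ 2 * (L * (5 * (d : ℝ) * L * B₀ * (α₀ + α₁))) + 8 * (8 * B₀' * (5 * (d : ℝ) * L * B₀) * (α₀ + α₁)) := by
    positivity
  have hcK : 5 * (d : ℝ) * L * B₀ * (α₀ + α₁) ≤
      2 * (L * (5 * (d : ℝ) * L * B₀ * (α₀ + α₁))) + 8 * (8 * B₀' * (5 * (d : ℝ) * L * B₀) * (α₀ + α₁)) := by
    have h₁ : (1 : ℝ) * (5 * (d : ℝ) * L * B₀ * (α₀ + α₁)) ≤ L * (5 * (d : ℝ) * L * B₀ * (α₀ + α₁)) :=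
      mul_le_mul_of_nonneg_right hL' hcs0
    have h₂ : 0 ≤ 8 * (8 * B₀' * (5 * (d : ℝ) * L * B₀) * (α₀ + α₁)) := by positivity
    linarith
  have hc16 : 16 * (5 * (d : ℝ) * L * B₀ * (α₀ + α₁)) ≤ 1 := by linarith
  -- the gauge-fixed field and its CANONICAL masked exponent
  have hW : mgauge P.1.1 u (mgauge P.1.1 u⁻¹ P.2.1) = P.2.1 := mgauge_mgauge_inv P.1.1 P.2.1 u
  have hWu : ∀ x κ, mgauge P.1.1 u⁻¹ P.2.1 x κ ∈ unitaryUnits 𝔸 := mem_unitaryUnits_of_mgauge_eq P.1.2 P.2.2 hu hW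
  have hWA : ∀ j, j ≤ i.k → ∀ y τ, SideTouches (i.Ω j) y τ →
      mgauge P.1.1 u⁻¹ P.2.1 y τ = cfgExp i.η (logCfg i.η (mgauge P.1.1 u⁻¹ P.2.1)) y τ ∧
        ‖logCfg i.η (mgauge P.1.1 u⁻¹ P.2.1) y τ‖ ≤ (5 * (d : ℝ) * L * B₀ * (α₀ + α₁)) * ((L : ℝ) ^ j * i.η)⁻¹ :=
    fun j hj y τ h => ⟨(hleaf j hj (y, τ) h).1, (hleaf j hj (y, τ) h).2.2⟩
  obtain ⟨hA'sa, hA'eq, hA'zero⟩ := mlogCfg_spec i.hη hL1 i.k P.1.1 hWu hcs0 hc16 i.Ω hWA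
  set A' := mlogCfg i.k i.η i.Ω (mgauge P.1.1 u⁻¹ P.2.1) with hA'_def
  have hA'bd : ∀ j, j ≤ i.k → ∀ y τ, SideTouches (i.Ω j) y τ →
      mgauge P.1.1 u⁻¹ P.2.1 y τ = cfgExp i.η A' y τ ∧
        ‖A' y τ‖ ≤ (2 * (L * (5 * (d : ℝ) * L * B₀ * (α₀ + α₁))) + 8 * (8 * B₀' * (5 * (d : ℝ) * L * B₀) * (α₀ + α₁))) *
          ((L : ℝ) ^ j * i.η)⁻¹ := by
    intro j hj y τ h
    obtain ⟨hAA, hWexp⟩ := hA'eq j hj y τ h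
    refine ⟨hWexp, ?_⟩
    rw [hAA]
    have hη0 : 0 ≤ i.η := i.hη.le
    exact ((hWA j hj y τ h).2).trans (mul_le_mul_of_nonneg_right hcK (by positivity))
  have h137 := B8Eq142KLevelLocal.H42_of_inAx hd2 i.hη hL i.k P.1.2 hα₀ hα₁ hKS0 w5 w6 w7 w9 w10 w19 i.Ω i.hΩ i.Λs i.Λb i.hbox
    i.hclass hInA h34 hAx h135 (fun m W => IsLandau138W L m i.η (i.Ω 0) (i.Λs m) P.1.1 W) i.k i.hk le_rfl u
    (mgauge P.1.1 u⁻¹ P.2.1) A' hu hW h129 (hLan i.hk) hA'sa hA'bd hA'zero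
  exact ⟨⟨u, hu, huS⟩, h129, h137, hLan i.hk, fun j hj b hb => hleaf j hj b hb⟩

/-- ★ **THE EXISTENCE HALF OF THEOREM 4, `∃ cₑ > 0, B8.Thm4ExistsBody cₑ (5dLB₀)`, ON AN INDEX-MAPPED SUB-FAMILY `fam₃ ∘ ι`** of `zdGF3`
(`ι : J → ZdIdx d L`) whose members obey the boundary-layer law, from the THREE β existence sockets on the image of `ι` only (the (1.59) socket INLINE
per member: the body of `SockB9P3D4β` at the induction datum).  At `J :=` the cube sub-family of (1.131) (law `hlay` = `B8LeafKnitZd3CubBdryBeta.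
bdryLayer_cubeSubfamily`) this is the `H4` of `B8Prop6CubeMemberGaugedBdryBetaExists`.
[cite: Balaban1985RegularSpaces, Thm 4 p.88, Prop. 5 (1.107)–(1.108) p.94, (1.59) p.86, (1.31) p.82] -/
theorem thm4ExistsBody_zd3_map_bdryβ (hd2 : 2 ≤ d) {L : ℕ} (hL : 2 ≤ L) {β : ℝ} {len : Site d → ℝ} {B₀ B₀' cP Bbd : ℝ} (hB₀ : 0 < B₀)
    (hB₀' : 0 < B₀') (hB : 2 ≤ 5 * (d : ℝ) * L * B₀) (hcP : 0 < cP) (hBbd : 0 ≤ Bbd) (hBd : 4 * Bbd ≤ ((d : ℝ) * L - 1) * B₀)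
    {J : Type} (ι : J → ZdIdx d L)
    (hlay : ∀ j : J, ∀ m, 1 ≤ m → m ≤ (ι j).k → ∀ y z : Site d, y ∈ (ι j).Ω 0 → z ∉ (ι j).Ω 0 →
      (∀ l, y l - 1 ≤ z l ∧ z l ≤ y l + 1) → y ∈ (ι j).Λs m 0)
    (SP5base : ∀ j : J, SockP5base (𝔸 := 𝔸) L B₀ B₀' cP (ι j).η (ι j).k (ι j).Ω (ι j).Λs)
    (SP5 : ∀ j : J, SockP5 (𝔸 := 𝔸) L B₀ B₀' cP (ι j).η (ι j).k (ι j).Ω (ι j).Λs)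
    (SH59Dβ : ∀ j : J, ∀ α₀ α₁ : ℝ, 0 < α₀ → 0 < α₁ → α₀ + α₁ ≤ cP →
        ∀ U₀ U' : Site d → Fin d → 𝔸ˣ, (∀ x κ, U₀ x κ ∈ unitaryUnits 𝔸) → (∀ x κ, U' x κ ∈ unitaryUnits 𝔸) →
        InAk L (ι j).k (ι j).η α₀ (ι j).Ω U₀ → InAk L (ι j).k (ι j).η α₀ (ι j).Ω (mulCfg U' U₀) →
        (∀ m, m ≤ (ι j).k → InAx L m ((ι j).Λs m) U₀ (mulCfg U' U₀)) →
        (∀ j', j' ≤ (ι j).k → ∀ (z : Site d) (μ : Fin d), (∀ x, InBox (loK L j' z) (bondHiK L j' z μ) x → x ∈ (ι j).Ω j') →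
          ‖(avgIter L (mulCfg U' U₀) j' z μ : 𝔸) - (avgIter L U₀ j' z μ : 𝔸)‖ ≤ α₁) →
        (∀ b ∈ {b : Site d × Fin d | SideTouches ((ι j).Ω 0) b.1 b.2}, ‖((U' b.1 b.2 : 𝔸ˣ) : 𝔸) - 1‖ ≤ α₁) →
        (∀ m, 1 ≤ m → m ≤ (ι j).k → ∀ (u : Site d → 𝔸ˣ) (W : Site d → Fin d → 𝔸ˣ) (A' : Site d → Fin d → 𝔸),
          (∀ x, u x ∈ unitaryUnits 𝔸) → (∀ x, x ∉ (ι j).Ω 0 → u x = 1) → mgauge U₀ u W = U' → Restr129 L m ((ι j).Λs m) U₀ u →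
          IsLandau138W L m (ι j).η ((ι j).Ω 0) ((ι j).Λs m) U₀ W → (∀ y τ, IsSelfAdjoint (A' y τ)) →
          (∀ j', j' ≤ m → ∀ y τ, SideTouches ((ι j).Ω j') y τ →
          W y τ = cfgExp (ι j).η A' y τ ∧ ‖A' y τ‖ ≤ (2 * (L * (5 * (d : ℝ) * L * B₀ * (α₀ + α₁))) + 8 * (8 * B₀' * (5 * (d : ℝ) * L * B₀) * (α₀ + α₁))) * ((L : ℝ) ^ j' * (ι j).η)⁻¹) →
          (∀ y τ, (∀ j', j' ≤ m → ¬ SideTouches ((ι j).Ω j') y τ) → A' y τ = 0) →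
          msup L m (ι j).η (-(1 : ℝ)) (fun j' (b : Site d × Fin d) => SideTouches ((ι j).Ω j') b.1 b.2) (fun b => A' b.1 b.2)
          ≤ B₀ * (bondNorm L m (ι j).η (-(3 : ℝ)) (ι j).Ω (fun x μ => Jcur (ι j).η U₀ A' μ x)
          + wsup 1 (fun p : {p : ℕ × (Site d × Fin d) // p.1 ≤ m ∧ (p.2 ∈ (ι j).Λb m p.1 ∨ (p.1 = 0 ∧ CrossB ((ι j).Ω 0) p.2))} =>
          linCovIter L U₀ (iEta (ι j).η A') p.1.1 p.1.2.1 p.1.2.2))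
          + Bbd * msup L m (ι j).η (-(1 : ℝ)) (fun j' (b : Site d × Fin d) => j' = 0 ∧ SideTouches ((ι j).Ω 0) b.1 b.2 ∧ ¬ BondTouches ((ι j).Ω 0) b.1 b.2)
              (fun b => A' b.1 b.2) ∧
          msup L m (ι j).η (-(2 : ℝ)) (fun j' (t : Fin d × Fin d × Site d) => SideTouches ((ι j).Ω j') t.2.2 t.2.1)
          (fun t => covDerivFwd (ι j).η U₀ t.1 (fun z => A' z t.2.1) t.2.2)
          ≤ B₀ * (bondNorm L m (ι j).η (-(3 : ℝ)) (ι j).Ω (fun x μ => Jcur (ι j).η U₀ A' μ x)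
          + wsup 1 (fun p : {p : ℕ × (Site d × Fin d) // p.1 ≤ m ∧ (p.2 ∈ (ι j).Λb m p.1 ∨ (p.1 = 0 ∧ CrossB ((ι j).Ω 0) p.2))} =>
          linCovIter L U₀ (iEta (ι j).η A') p.1.1 p.1.2.1 p.1.2.2))
          + Bbd * msup L m (ι j).η (-(1 : ℝ)) (fun j' (b : Site d × Fin d) => j' = 0 ∧ SideTouches ((ι j).Ω 0) b.1 b.2 ∧ ¬ BondTouches ((ι j).Ω 0) b.1 b.2)
              (fun b => A' b.1 b.2))) :
    ∃ cₑ : ℝ, 0 < cₑ ∧ B8.Thm4ExistsBody cₑ (5 * (d : ℝ) * L * B₀) (fun j : J => (zdGF3 𝔸 L β len (ι j)).toGFData) := by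
  obtain ⟨c₁, hc₁, H⟩ := thm4ExistsBody_member_zd3_bdryβ (𝔸 := 𝔸) hd2 hL β len hB₀ hB₀' hB hcP hBbd hBd
  exact ⟨c₁, hc₁, fun j => H (ι j) (hlay j) (SP5base j) (SP5 j) (SH59Dβ j) ()⟩

end Member

#print axioms thm4ExistsBody_member_zd3_bdryβ
#print axioms thm4ExistsBody_zd3_map_bdryβ

end Literature.MathematicalPhysics.QuantumFieldTheory.Balaban1983to89.B8Thm4ExistsZd3BdryBeta

end

/-! ## HONEST SCOPE — VACUOUS AT NESTED MEMBERS AS TYPED (2026-08-27, seat `pub-ymgap-dag-n05-e` g9; director-ym LINE №196, dag-lead DEDUP-349∕350)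

This file is MEMBER-GENERIC: its theorems take a (1.59)-type clause or socket in EDITION β (SCALAR SC2-shape, or the 𝔸-valued `SockB9P3D4β` ∕ `H59Dβ` ∕
four-line bodies) over a datum class `Λb` obeying the law «fine box ⊂ Ω_j» (`hbox`, `ZdIdx.hbox`, `cubeLamB` condition 1).  At every NESTED member with
genuine shells — in particular every cube member of (1.131) with `k ≥ 1` — that law EMPTIES print's crossing bonds of (1.31) at levels `j ≥ 1` and the interior
SHELL GAUGE MODES `∂(𝟙λ)` defeat the clause for ALL constants: there the hypothesis is UNINHABITED and the theorems are VACUOUS AS TYPED — KERNEL CERTIFICATE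
dag-n05-c `B8Ineq159FlatShellModeVacuity` (p572834; ref-E g12 READ-11 A6-FINAL) and `…ShellModeVacuityUniv` (p576185, the lawful `Ω₀ = ℤᵈ` towered member).
No claim is made here about tower-free members.  The theorems stay TRUE and PASS-AS-DECLARED.  Nothing of [Balaban1985RegularSpaces] is refuted: print's class
([B6] (2.3)) contains the crossing bonds and kills the modes (dag-n05-c `B8Ineq159FlatShellModeCrossingDatum`).  SUPERSEDED BY EDITION γ: class dag-n05-c
`cubeLamBP`, socket dag-n06-b `B9SupplySockB9P3ZdGamma`, driver this seat's `B8Eq142KLevelLocalGamma` ∕ `B8Thm4KLevelGamma` (law «box ⊂ Ω_{j−1}»); this file is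
kept as history and for its class-independent mechanics, re-run by token swap in γ.  Count-neutral; N05 NOT discharged; nothing continuum ∕ ℝ⁴ ∕ OS ∕
mass-gap ∕ Clay. -/
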